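import Summits.BirchSwinnertonDyer.Rank1Residual.F1Sign2.EggLemmaAtTwoProofs
import HarnessLib

/-!
# Cell `bsd-f1-sign2` — analytic / Waldspurger–Gross–Zagier lens (seat `-an` g5, MEMO-an v1.9 §2 AN-13): the ± object
# at 2 for rank one is the REAL COMPONENT OF THE HEEGNER POINT («egg bit»)

For `Δ_E > 0` the real locus `E(ℝ) ≅ ℝ/ℤ × ℤ/2` has two components and `2·E(ℝ) = E⁰(ℝ)`. When
`rank E(ℚ) = 1` the Heegner point `y_K ∈ E(K)` is rational up to torsion (`ȳ_K = −ε_f y_K + t`,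
Gross 1984), so it carries an ARCHIMEDEAN BIT `b(E,K) = [y_K ∉ E⁰(ℝ)]` («the Heegner point lies on the egg»).

* EGG LEMMA (elementary; support): for `Δ > 0`, `E(ℚ)[2] = 0`, `K` imaginary quadratic, a rational point on
  the egg is not in `2E(K) + E(K)_tors` (`E(K)[2] = 0` as the 2-division cubic is irreducible; odd torsion is
  2-divisible inside itself, so `R = 2Q'` over `K`; then `Q' − σQ' ∈ E(K)[2] = 0`, `Q' ∈ E(ℚ)`, and
  `R ∈ 2E(ℝ) = E⁰(ℝ)` for `Δ > 0` — contradiction). Hence on the cell's locus `b(E,K) = (I_K mod 2)·[ε = +1]`, `I_K = [E(K) : ℤy_K + tors]`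
  (census T13.1: 4 388/4 388).
* AN-13 `HeegnerPointOnEggAtTwo` (conjecture-grade): `ε = +1` (E(ℚ) meets the egg), `K` descent-admissible,
  `c · Tam(E)` odd ⟹ `y_K` lies on the egg. By the egg lemma this is `y_K ∉ 2E(K) + tors`, i.e. the first
  Kolyvagin class `c(1) = δ(y_K) ∈ H¹(K, E[2])` is NON-ZERO — W. Zhang's theorem (Camb. J. Math. 2 (2014)
  Thm 1.1, `p ≥ 5` ordinary, Hypothesis ♠) transposed to `p = 2`, where Zhang's input «Sel_p(E/K) has rank one»
  is supplied unconditionally and class-wide by Kramer 1981 (`dim Sel₂(E/K) = 1 ⟺ ε = +1` on admissible `K`,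
  -desc THEOREM A / AN-10K⁼) and Hypothesis ♠ (ρ̄ ramified at `ℓ ∥ N`) becomes «`c_ℓ` odd». Census T13.2:
  1 960/1 960 (ε = +1, Tam odd: bit 1), 1 828/1 828 (ε = +1, Tam even: bit 0), 580/580 (ε = −1: bit 0), all
  three reduction types at 2 (ss 432 / mult 1 130 / ord 398 among the bit-1 rows).
* AN-13⁺ `HeegnerEggLawAtTwo` (the full law, both directions): for `d_K ≡ 1 (mod 8)`, `(d_K, N) = 1`, Heegner:
  `y_K` on the egg ⟺ (`ε = +1` ∧ `K` admissible ∧ `c·Tam(E)` odd); 4 732/4 732 pairs (incl. 344 torsion `y_K`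
  and 48 non-admissible controls, all bit 0).
Consequences: bit 1 ⟹ `y_K` non-torsion ⟹ `L(E^{(d_K)},1) ≠ 0` (Gross–Zagier) — an archimedean certificate
of non-vanishing; with the P2 door (`bsdp_iff_bsdp_twist_of_heegnerIndexOverK`, Kramer `Ш(E/K)[2] = 0`) the
2-part of BSD for `E/K` on the `c·Tam`-odd egg locus IS the statement `b(E,K) = 1`.
This file asserts no arithmetic fact: `Prop`s (four `def`s with bodies: the support `EggLemma`, theorem-grade, and three
`@[conjecture]` candidates = OPEN obligations of ours) + three proved implications. [cite: Zhang2014CJM, Thm 1.1, 1.3]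
[cite: Gross1984, §3–5] [cite: GrossZagier1986, V.(2.2)] [cite: Kramer1981, Thm 1, Prop 6]

REF2-PLACEMENT-v13 (5febabf99e94ccd2) §2 (2026-08-27T20:20:51Z pre-placement; 20:23:27Z: stands as FINAL after reading
MEMO-an v1.9 f5872e0c19a50ca5): `EggLemma` = folklore, THEOREM-grade (irreducible cubic has no root in a quadratic field ⇒
`E(K)[2] = 0`; `m` odd, `mR ∈ 2E(ℚ) ⊂ E⁰(ℝ)` ⇒ `R ∈ E⁰(ℝ)`). `HeegnerPointOnEggAtTwo` / `HeegnerKummerClassNonzeroAtTwo` =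
IN-PRINT-ASSEMBLY, CONJECTURE-grade at `2`: on this locus Kramer gives rank `E(K) = 1`, `Ш(E/K)[2] = 0`, so
«`y_K ∉ 2E(K)+tors`» ⟺ `I_K` odd ⟺ (GZ86 V.(2.2), Tam & `c_E` odd) BSD₂(E/K) — AN-13 is the Tam-odd SLICE of AN-10H
(`DescentSignHeegnerIndexAtTwo`, p565561), and its other name is Kolyvagin's conjecture `c(1) ≠ 0` at `p = 2` in the
Sel₂-rank-one case: Zhang 2014 standing hypothesis «`p ≥ 5`» [doi-10-4310-cjm-2014-v2-n2-a2 p0003 L37], Thm 1.1/1.2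
[p0005 L12–32]; Jetchev 2008 Hyp (*) is «an odd prime `p`» [arxiv-math_0703431 p0003 L32–36] — so the Jetchev cite in
`HeegnerEggLawAtTwo`'s ⟹ direction is ANALOGY ONLY; Kriz–Li 2019 Rem 1.14 («p-converse for p = 2 not known»). Printed
THEOREM corner at `p = 2` (non-CM), the same class `δ(y_K) ∈ Sel₂(E/K) ≅ 𝔽₂` read at the prime 2 instead of at `∞`:
Kriz–Li 2019 Lemma 5.4 / Cor 5.5 (arXiv Lemma 4.1/Cor 4.2) under (★) (2 split in `K`, `c₂` odd, a 2-adic unit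
condition on `log_ω P`); the archimedean reading is unprinted; beyond-print theorem: no.

TYPER FILING (seat `bsd-f1-sign2-ty` g2, D-ty-9; CANDIDATES.md rows AN-13 / AN-13′ / AN-13⁺ / EGG-LEMMA): bodies
VERBATIM from `HOME/MEMO-an-data/g5/Sketch_v6.lean` 6879b8d07fb7f041 (-an g5; rc 0 / 0 sorry; BC7 3/3 CLEAN
`g5/bc7_probe_stdout.txt` 8f2682e9be69e1d4); the three candidates tagged `@[conjecture]`; the predicates `EggUpToTorsion` / `NotTwiceUpToTorsion` and the
support statement `EggLemma` are the tree's (`EggLemmaAtTwo.lean` p569502; `EggLemma` PROVED as `EggDoubling.eggLemma` in `EggLemmaAtTwoProofs.lean` p571053, imported, so the AN-13 ⇒ AN-13′ link below is hypothesis-free); bib keys `Zhang2014CJM` added,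
`Silverman2009AEC` ↦ tree key `SilvermanAEC2009`. LINE: `g5/line-egg-kolyvagin-two.lean` 3dc532d8e2b1ff45 on crux
`stmt-BirchSwinnertonDyer-19099` (`RankOneAtTwo_of` kernel-checked, 7 stubs, hardest `S_kolyvaginTwo` = AN-13′;
evidence #5–#8 on 19099). REF1-AUDIT-v1 §31 (ff0d73276419a055, 2026-08-27T21:38:02Z; evidence `HOME/REF1-data/b28/`): as-is rc 0,
decl compare Sketch_v6 ↔ Sketch_v7 ↔ EggDoubling all SAME (the AN-13 ⇒ AN-13′ glue hypothesis-free via the tree theorem `eggLemma`),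
A1 rc 0 (guards: `EggUpToTorsion → MeetsEgg` tautology, `Iff.rfl` of the Kummer form, `(-7 : ℤ) % 8 = 1`), `#print axioms` of
`eggLemma` / glues standard, BC7 CLEAN; junk families checked (Dt-scaling with m odd invariant; the Heegner hypothesis automatic under
`DescAdmissible`; an empty `HeegnerDatum` type off-Heegner makes rows of AN-13⁺ vacuously true only there, harmless; a torsion `P` is
not constructible on the locus); verdicts AN-13 `HeegnerPointOnEggAtTwo` / AN-13⁺ `HeegnerEggLawAtTwo` SURVIVE conjecture-grade
(= Kolyvagin `c(1) ≢ 0 (mod 2)` = 2-converse ∧ [GZ ⊗ BSD(E/K)]₂ on Kramer's locus; «file `@[conjecture]`»), AN-13′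
`HeegnerKummerClassNonzeroAtTwo` implied by AN-13 via `eggLemma` (kept `@[conjecture]`: open, same strength). PARTITION: none moved;
beyond-print theorem: no.
-/

noncomputable section

open scoped Classical

namespace Summit.BirchSwinnertonDyer.Rank1Residual.F1Sign2

open Literature.NumberTheory.EllipticCurves Literature.NumberTheory.EllipticCurves.ModularForms

set_option autoImplicit false

section EggBit

/-- **AN-13 `HeegnerPointOnEggAtTwo` (conjecture-grade; Kolyvagin's conjecture `c(1) ≢ 0 (mod 2)` under
Kramer, read at the real place).** `W/ℚ` globally minimal, `Δ > 0`, `E(ℚ)[2] = 0`, `rank E(ℚ) = 1`,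
`Ш(E)[2] = 0`, `E(ℚ)` MEETS THE EGG (`ε = +1`), `∏_ℓ c_ℓ(E)` odd; `K` imaginary quadratic with
descent-admissible discriminant; `P ∈ E(K)` maps to the Heegner point of a parametrisation datum `Dt` with
ODD constant `Dt.c`. Then `P` is rational-on-the-egg up to torsion. Census T13.2 (ENGINE E lattice
coordinates, 200 bits): 1 960/1 960; falsifier = one admissible pair with `ε = +1`, `Tam` odd and
`ω₂`-coordinate of `z_K` `≡ 0`: 0/1 960. Why it might fail: it is the `p = 2` case of Zhang's
indivisibility theorem, open in print at `2` (Zhang needs `p ≥ 5` ordinary); the bit-1 rows include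
supersingular and multiplicative reduction at `2`. [cite: Zhang2014CJM, Thm 1.1] [cite: Kramer1981, Thm 1]
[cite: GrossZagier1986, V.(2.2)] -/
@[conjecture] def HeegnerPointOnEggAtTwo : Prop :=
  ∀ (W : WeierstrassCurve ℚ) [W.IsElliptic] [W.IsGloballyMinimal] [NeZero (W.conductorNorm ℤ)],
    0 < W.Δ → NoRationalTwoTorsion W → W.mordellWeilRank = 1 → ShaTwoTrivial W → MeetsEgg W →
    ¬ 2 ∣ W.tamagawaProduct →
    ∀ (K : Type) [Field K] [NumberField K], IsImaginaryQuadratic K →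
      DescAdmissible W (NumberField.discr K) →
      ∀ (Dt : ModularParametrizationData W (W.conductorNorm ℤ))
        (H : HeegnerDatum (W.conductorNorm ℤ) (NumberField.discr K)) (ι : K →+* ℂ)
        (P : (W.baseChange K).toAffine.Point),
        WeierstrassCurve.Affine.Point.map ι.toRatAlgHom P = heegnerPointComplex Dt H →
        ¬ (2 : ℤ) ∣ Dt.c →
          EggUpToTorsion W K P

/-- **AN-13′ `HeegnerKummerClassNonzeroAtTwo` (same hypotheses; the Kummer-class form = AN-10H⁺ on the
`c·Tam`-odd locus without the index).** The Heegner point is not in `2E(K) + E(K)_tors`, i.e. its class in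
`Sel₂(E/K) ≅ 𝔽₂` (Kramer, `ε = +1`) is the non-zero one. [cite: Zhang2014CJM, Thm 1.1] [cite: Kramer1981, Thm 1] -/
@[conjecture] def HeegnerKummerClassNonzeroAtTwo : Prop :=
  ∀ (W : WeierstrassCurve ℚ) [W.IsElliptic] [W.IsGloballyMinimal] [NeZero (W.conductorNorm ℤ)],
    0 < W.Δ → NoRationalTwoTorsion W → W.mordellWeilRank = 1 → ShaTwoTrivial W → MeetsEgg W →
    ¬ 2 ∣ W.tamagawaProduct →
    ∀ (K : Type) [Field K] [NumberField K], IsImaginaryQuadratic K →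
      DescAdmissible W (NumberField.discr K) →
      ∀ (Dt : ModularParametrizationData W (W.conductorNorm ℤ))
        (H : HeegnerDatum (W.conductorNorm ℤ) (NumberField.discr K)) (ι : K →+* ℂ)
        (P : (W.baseChange K).toAffine.Point),
        WeierstrassCurve.Affine.Point.map ι.toRatAlgHom P = heegnerPointComplex Dt H →
        ¬ (2 : ℤ) ∣ Dt.c →
          NotTwiceUpToTorsion W K P

/-- Kernel-checked link: the egg lemma turns the archimedean statement AN-13 into the Kummer-class
statement AN-13′ (Kolyvagin's `c(1) ≠ 0` at `2`). -/
theorem heegnerKummerClassNonzeroAtTwo_of_eggLemma_of_onEgg (hEgg : EggLemma)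
    (h13 : HeegnerPointOnEggAtTwo) : HeegnerKummerClassNonzeroAtTwo := by
  intro W _ _ _ hΔ h2 hr hSha hMeets hTam K _ _ hK hAdm Dt H ι P hP hc
  exact hEgg W hΔ h2 K hK P (h13 W hΔ h2 hr hSha hMeets hTam K hK hAdm Dt H ι P hP hc)

/-- Kernel-checked link, hypothesis-free form: AN-13 ⇒ AN-13′, the egg lemma being PROVED in the tree
(`EggDoubling.eggLemma`, `F1Sign2/EggLemmaAtTwoProofs.lean`). -/
theorem heegnerKummerClassNonzeroAtTwo_of_onEgg (h13 : HeegnerPointOnEggAtTwo) :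
    HeegnerKummerClassNonzeroAtTwo :=
  heegnerKummerClassNonzeroAtTwo_of_eggLemma_of_onEgg EggDoubling.eggLemma h13

/-- **AN-13⁺ `HeegnerEggLawAtTwo` (the full egg law; both directions; 4 732/4 732 pairs).** Same curve
hypotheses WITHOUT the sign / Tamagawa conditions; `K` imaginary quadratic with `d_K ≡ 1 (mod 8)`,
`(d_K, N) = 1`, a Heegner datum (so every `ℓ ∣ N` splits); `Dt.c` odd. Then the Heegner point is
rational-on-the-egg up to torsion IFF `E(ℚ)` meets the egg AND `d_K` is descent-admissible (every `a_q(E)`,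
`q ∣ d_K`, odd) AND `∏_ℓ c_ℓ(E)` is odd. (`⟸` = AN-13; `⟹` = «egg ⟹ admissible ∧ Tamagawa-odd», the parity
shadow of Jetchev-type Tamagawa divisibility of the Heegner index and of Kramer's local norm indices at
`q ∣ d_K`, at the prime 2.) Census T13: bit-1 rows 1 960 = RHS-true rows 1 960; bit-0 rows 2 772 (1 828 Tam
even, 580 + 316 `ε = −1`, 48 non-admissible). REF2 v13 §2.3: IN-PRINT-ASSEMBLY conjecture-grade; the Jetchev 2008
Tamagawa-divisibility theorem is for ODD `p` (Hyp. (*)), cited as ANALOGY ONLY for the ⟹ direction at `2`.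
[cite: Zhang2014CJM, Thm 1.1] [cite: Jetchev2008, Thm. 1.4 (odd p; analogy)] [cite: Kramer1981, Thm 1, Prop 6] -/
@[conjecture] def HeegnerEggLawAtTwo : Prop :=
  ∀ (W : WeierstrassCurve ℚ) [W.IsElliptic] [W.IsGloballyMinimal] [NeZero (W.conductorNorm ℤ)],
    0 < W.Δ → NoRationalTwoTorsion W → W.mordellWeilRank = 1 → ShaTwoTrivial W →
    ∀ (K : Type) [Field K] [NumberField K], IsImaginaryQuadratic K →
      NumberField.discr K % 8 = 1 → Nat.Coprime (NumberField.discr K).natAbs (W.conductorNorm ℤ) →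
      ∀ (Dt : ModularParametrizationData W (W.conductorNorm ℤ))
        (H : HeegnerDatum (W.conductorNorm ℤ) (NumberField.discr K)) (ι : K →+* ℂ)
        (P : (W.baseChange K).toAffine.Point),
        WeierstrassCurve.Affine.Point.map ι.toRatAlgHom P = heegnerPointComplex Dt H →
        ¬ (2 : ℤ) ∣ Dt.c →
          (EggUpToTorsion W K P ↔
            (MeetsEgg W ∧ DescAdmissible W (NumberField.discr K) ∧ ¬ 2 ∣ W.tamagawaProduct))

/-- The full law contains AN-13 (kernel-checked bookkeeping). -/
theorem heegnerPointOnEggAtTwo_of_law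
    (hmod8 : ∀ (W : WeierstrassCurve ℚ) [W.IsGloballyMinimal] (d : ℤ), DescAdmissible W d → d % 8 = 1)
    (hcop : ∀ (W : WeierstrassCurve ℚ) [W.IsElliptic] [W.IsGloballyMinimal] [NeZero (W.conductorNorm ℤ)]
      (d : ℤ), DescAdmissible W d → Nonempty (HeegnerDatum (W.conductorNorm ℤ) d) →
      Nat.Coprime d.natAbs (W.conductorNorm ℤ))
    (hLaw : HeegnerEggLawAtTwo) : HeegnerPointOnEggAtTwo := by
  intro W _ _ _ hΔ h2 hr hSha hMeets hTam K _ _ hK hAdm Dt H ι P hP hc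
  exact (hLaw W hΔ h2 hr hSha K hK (hmod8 W _ hAdm) (hcop W _ hAdm ⟨H⟩) Dt H ι P hP hc).2
    ⟨hMeets, hAdm, hTam⟩

/-- The first bookkeeping hypothesis of `heegnerPointOnEggAtTwo_of_law` holds by definition of
`DescAdmissible`. -/
theorem descAdmissible_mod_eight (W : WeierstrassCurve ℚ) [W.IsGloballyMinimal] (d : ℤ)
    (h : DescAdmissible W d) : d % 8 = 1 := h.2.2.1

end EggBit

end Summit.BirchSwinnertonDyer.Rank1Residual.F1Sign2

end
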